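import Summits.HodgeConjecture.HodgeConjecture.Theses.DerivedTorelliFermat
import Summits.HodgeConjecture.HodgeConjecture.Theorems.DerivedTorelliFermatK3ExhaustionRecord

/-!
# Refutation of `DerivedTorelliFermat.K3Exhaustion` (stmt-HodgeConjecture-11121)

`K3Exhaustion` claims for EVERY degree `m` that each Hodge multiset of cardinality `6` in `ℤ/m` (a Hodge
character of the Fermat fourfold `X⁴ₘ` up to permutation) is Shioda–Aoki reachable (after adding
cancelling pairs `Q + (−Q)`, a sum of Hodge multisets of cardinality `≤ 4`, Hodge semi-decomposable
sextuples and `5`-standard sextuples) or K3-sector (`s = {β₀,β₁,β₂} + {γ₀,γ₁,γ₂}`, `β` admissible with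
EXACTLY ONE level-`1` character in its unit orbit).  False at `m = 110` [refuted-substantive]: the Hodge
sextuple `s₀ = {1, 24, 62, 71, 81, 91} ⊂ ℤ/110` is (i) not reachable — the odd functional `ψ = ±1` on
`±{9, 13, 18, 26, 29, 37}` gives an additive `Ψ(u) = Σ_{a∈u} ψ(a)` killing `Q + (−Q)` and every
allowed part (finite checks) while `Ψ(s₀) = −1`; (ii) not K3-sector — each `3`-sub-multiset
`{β₀,β₁,β₂} ≤ s₀` has TWO distinct level-`1` characters in the unit orbit of `(β₀,β₁,β₂,−Σβᵢ)`.  Witness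
first announced by refuter g41-49, confirmed by this seat's exact census (`census3.py`, reachability by
DFS witness / integer-lattice non-membership / Farkas certificate; `m = 110` is the first bad degree, 24
such sextuples).  No cheap repair: `ψ` is a new invariant of Shioda's semigroup `M₁₁₀` vanishing on all
generators the route allows; restricting `m` breaks the `∀ m` target.  barrier-candidate:
Shioda–Aoki(+pairs)+K3-sector exhaustion of Hodge sextuples fails from `m = 110`.  Finite checks by
`native_decide` (computational, D-0022); the semi-decomposable check is a verified bucket look-up
(partners of a triple found by eight Hodge equations).  Refuter refuter-refute-pool-g43-4, 2026-08-15.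
-/

namespace Summit.HodgeConjecture.HodgeConjecture.Theorems

open Literature.AlgebraicGeometry.HodgeTheory
open Literature.AlgebraicGeometry.HodgeTheory.FermatCharacter

namespace DerivedTorelliFermatK3ExhaustionRefutation

/-- The witness: a Hodge sextuple of `ℤ/110` outside both alternatives. [folklore] -/
private def s₀ : Multiset (ZMod 110) := {1, 24, 62, 71, 81, 91}

/-- The elements of `s₀`, as a list. [folklore] -/
private def L₀ : List (ZMod 110) := [1, 24, 62, 71, 81, 91]

/-- The obstruction `ψ : ℤ/110 → ℤ`, odd, supported on `±{9, 13, 18, 26, 29, 37}`. [folklore] -/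
private def psi (a : ZMod 110) : ℤ :=
  if a = 9 ∨ a = 13 ∨ a = 18 ∨ a = 26 ∨ a = 29 ∨ a = 37 then 1
  else if a = 101 ∨ a = 97 ∨ a = 92 ∨ a = 84 ∨ a = 81 ∨ a = 73 then -1 else 0

/-- `Ψ(u) = Σ_{a ∈ u} ψ(a)`. [folklore] -/
private def Psi (u : Multiset (ZMod 110)) : ℤ := (u.map psi).sum

/-- `Ψ` is additive. [folklore] -/
private theorem Psi_add (u v : Multiset (ZMod 110)) : Psi (u + v) = Psi u + Psi v := by
  simp [Psi, Multiset.map_add, Multiset.sum_add]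

/-- `Ψ(0) = 0`. [folklore] -/
private theorem Psi_zero : Psi 0 = 0 := by simp [Psi]

/-- `ψ` is odd (finite check). [folklore] -/
private theorem psi_neg : ∀ a : ZMod 110, psi (-a) = -psi a := by decide

/-- `Ψ` kills the cancelling pairs `Q + (−Q)`. [folklore] -/
private theorem Psi_pairs (Q : Multiset (ZMod 110)) : Psi (Q + Q.map fun a => -a) = 0 := by
  simp only [Psi, Multiset.map_add, Multiset.sum_add, Multiset.map_map, Function.comp_def]
  rw [← Multiset.sum_map_add]
  simp [psi_neg]

/-- If `ψ` vanishes on every element then `Ψ = 0`. [folklore] -/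
private theorem Psi_eq_zero_of_forall {u : Multiset (ZMod 110)} (h : ∀ a ∈ u, psi a = 0) :
    Psi u = 0 := by
  unfold Psi
  apply Multiset.sum_eq_zero
  intro x hx
  obtain ⟨a, ha, rfl⟩ := Multiset.mem_map.mp hx
  exact h a ha

/-- The `40` units of `ℤ/110`, as residues. [folklore] -/
private def U110 : List (ZMod 110) :=
  [1, 3, 7, 9, 13, 17, 19, 21, 23, 27, 29, 31, 37, 39, 41, 43, 47, 49, 51, 53, 57, 59, 61, 63, 67,
    69, 71, 73, 79, 81, 83, 87, 89, 91, 93, 97, 101, 103, 107, 109]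

/-- The listed residues are coprime to `110` (finite check). [folklore] -/
private theorem coprime_of_mem_U110 : ∀ x ∈ U110, Nat.Coprime x.val 110 := by decide +kernel

/-- Every residue coprime to `110` is listed (finite check). [folklore] -/
private theorem mem_U110_of_coprime : ∀ x : ZMod 110, Nat.Coprime x.val 110 → x ∈ U110 := by
  decide +kernel

/-- Every unit of `ℤ/110` is listed. [folklore] -/
private theorem mem_U110 (t : (ZMod 110)ˣ) : (t : ZMod 110) ∈ U110 :=
  mem_U110_of_coprime _ (ZMod.val_coe_unit_coprime t)

/-- The Hodge equations at all units of `ℤ/110` restrict to the explicit list `U110`. [folklore] -/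
private theorem hodge_U110 {κ : Multiset (ZMod 110)}
    (h : ∀ t : (ZMod 110)ˣ,
      2 * mNormSum (κ.map fun a => (t : ZMod 110) * a) = 110 * Multiset.card κ) :
    ∀ x ∈ U110, 2 * mNormSum (κ.map fun a => x * a) = 110 * Multiset.card κ := by
  intro x hx
  have := h (ZMod.unitOfCoprime x.val (coprime_of_mem_U110 x hx))
  rwa [ZMod.coe_unitOfCoprime, ZMod.natCast_zmod_val] at this

/-- `#s₀ = 6`. [folklore] -/
private theorem s₀_card : Multiset.card s₀ = 6 := by decide

/-- `s₀` is a Hodge multiset (Hodge equations checked on the listed units). [folklore] -/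
private theorem s₀_isHodge : IsHodgeMultiset s₀ := by
  refine ⟨⟨by decide, by decide⟩, fun t => ?_⟩
  have key : ∀ x ∈ U110, 2 * mNormSum (s₀.map fun a => x * a) = 110 * Multiset.card s₀ := by
    decide +kernel
  exact key _ (mem_U110 t)

/-- `Ψ(s₀) = −1`. [folklore] -/
private theorem Psi_s₀ : Psi s₀ = -1 := by decide

/-- `N_x` of the zero-sum triple `(y, b, −(y+b))`. [folklore] -/
private def nrm3 (x y b : ZMod 110) : ℕ := (x * y).val + (x * b).val + (x * -(y + b)).val

/-- `Ψ` of the zero-sum triple `(y, b, −(y+b))`. [folklore] -/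
private def psi3 (y b : ZMod 110) : ℤ := psi y + psi b + psi (-(y + b))

/-- The first eight units (the bucket key). [folklore] -/
private def U8 : List (ZMod 110) := [1, 3, 7, 9, 13, 17, 19, 21]

/-- `U8 ⊆ U110`. [folklore] -/
private theorem U8_subset : ∀ x ∈ U8, x ∈ U110 := by decide +kernel

/-- Key of a triple: its first eight Hodge sums. [folklore] -/
private def keyOf (d e : ZMod 110) : List ℕ := U8.map fun x => nrm3 x d e

/-- Key of the Hodge partners of a triple. [folklore] -/
private def coKey (y b : ZMod 110) : List ℕ := U8.map fun x => 330 - nrm3 x y b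

/-- All residues and all ordered pairs of residues. [folklore] -/
private def allRes : List (ZMod 110) := (List.range 110).map fun n => (n : ZMod 110)

/-- All pairs `(d, e)` with their keys. [folklore] -/
private def Utab : List (List ℕ × (ZMod 110 × ZMod 110)) :=
  allRes.flatMap fun d => allRes.map fun e => (keyOf d e, (d, e))

/-- The table of pairs bucketed by key. [folklore] -/
private def table : List (List ℕ × List (ZMod 110 × ZMod 110)) :=
  ((Utab.map Prod.fst).eraseDups).map fun k => (k, (Utab.filter fun q => q.1 == k).map Prod.snd)

/-- The bucket of a key. [folklore] -/
private def bucket (k : List ℕ) : List (ZMod 110 × ZMod 110) :=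
  match table.find? fun q => q.1 == k with
  | some q => q.2
  | none => []

/-- Every pair lies in the bucket of its key (native evaluation). [folklore] -/
private theorem bucket_complete : ∀ d e : ZMod 110, (d, e) ∈ bucket (keyOf d e) := by
  native_decide

/-- All forty Hodge equations of the sextuple `(y, b, −(y+b)) + (d, e, −(d+e))`. [folklore] -/
private def fullMatch (y b d e : ZMod 110) : Bool :=
  U110.all fun x => nrm3 x y b + nrm3 x d e == 330

/-- The semi-decomposable check for the triple `(y, b, −(y+b))`: every Hodge partner in its co-bucket
has cancelling `Ψ`. [folklore] -/
private def check6 (y b : ZMod 110) : Bool :=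
  (bucket (coKey y b)).all fun p => !fullMatch y b p.1 p.2 || psi3 y b + psi3 p.1 p.2 == 0

/-- Native evaluation of the semi-decomposable check over triples meeting `supp ψ`. [folklore] -/
private theorem check6_all :
    ∀ y : ZMod 110, psi y ≠ 0 → ∀ b : ZMod 110, check6 y b = true := by
  native_decide

/-- Semi-decomposable sextuples: `{y, b, −(y+b)} + {d, e, −(d+e)}` with `ψ y ≠ 0` satisfying the Hodge
equations at the units has `Ψ = 0`. [folklore] -/
private theorem core6 {y b d e : ZMod 110} (hy : psi y ≠ 0)
    (hH : ∀ x ∈ U110, nrm3 x y b + nrm3 x d e = 330) : psi3 y b + psi3 d e = 0 := by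
  have hk : keyOf d e = coKey y b := by
    unfold keyOf coKey
    apply List.map_congr_left
    intro x hx
    have := hH x (U8_subset x hx)
    omega
  have hmem : (d, e) ∈ bucket (coKey y b) := hk ▸ bucket_complete d e
  have hall := check6_all y hy b
  unfold check6 at hall
  rw [List.all_eq_true] at hall
  have h1 := hall (d, e) hmem
  have hfm : fullMatch y b d e = true := by
    unfold fullMatch
    rw [List.all_eq_true]
    intro x hx
    exact beq_iff_eq.mpr (hH x hx)
  rw [hfm] at h1
  simpa using h1

/-- Cardinality `4`: `{y, b, c, −(y+b+c)}` with `ψ y ≠ 0` satisfying the Hodge equations at the units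
has `Ψ = 0` (native evaluation). [folklore] -/
private theorem core4 : ∀ y : ZMod 110, psi y ≠ 0 → ∀ b c : ZMod 110,
    (∀ x ∈ U110, (x * y).val + (x * b).val + (x * c).val + (x * -(y + b + c)).val = 220) →
    psi y + psi b + psi c + psi (-(y + b + c)) = 0 := by
  native_decide

/-- `5`-standard sextuples (`d = 110/5 = 22`; native evaluation). [folklore] -/
private theorem core5 : ∀ a : ZMod 110,
    psi a + psi (a + ((110 / 5 : ℕ) : ZMod 110)) + psi (a + 2 * ((110 / 5 : ℕ) : ZMod 110)) +
      psi (a + 3 * ((110 / 5 : ℕ) : ZMod 110)) + psi (a + 4 * ((110 / 5 : ℕ) : ZMod 110)) +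
      psi (-(5 * a)) = 0 := by
  native_decide

/-- K3 clause: every `3`-sub-multiset `{b₀,b₁,b₂} ≤ s₀` has at least two characters of Hodge level `1`
(`Σ⟨δᵢ⟩ = 110`) in the unit orbit of `(b₀,b₁,b₂,−Σbᵢ)` (native evaluation). [folklore] -/
private theorem coreK3 : ∀ b₀ ∈ L₀, ∀ b₁ ∈ L₀, ∀ b₂ ∈ L₀,
    ({b₀, b₁, b₂} : Multiset (ZMod 110)) ≤ s₀ →
    ∃ t₁ ∈ U110, ∃ t₂ ∈ U110,
      (t₁ * b₀).val + (t₁ * b₁).val + (t₁ * b₂).val + (t₁ * -(b₀ + b₁ + b₂)).val = 110 ∧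
      (t₂ * b₀).val + (t₂ * b₁).val + (t₂ * b₂).val + (t₂ * -(b₀ + b₁ + b₂)).val = 110 ∧
      ¬ (t₁ * b₀ = t₂ * b₀ ∧ t₁ * b₁ = t₂ * b₁ ∧ t₁ * b₂ = t₂ * b₂) := by
  native_decide

/-- Parts of cardinality `≤ 4`. [folklore] -/
private theorem Psi_part4 (κ : Multiset (ZMod 110)) (hκ : IsHodgeMultiset κ)
    (hc : Multiset.card κ ≤ 4) : Psi κ = 0 := by
  by_cases hall : ∀ a ∈ κ, psi a = 0
  · exact Psi_eq_zero_of_forall hall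
  push Not at hall
  obtain ⟨y, hyκ, hψ⟩ := hall
  have hev := hκ.even_card
  obtain ⟨⟨-, hsum⟩, hN⟩ := hκ
  have hN' := hodge_U110 hN
  obtain ⟨κ', rfl⟩ := Multiset.exists_cons_of_mem hyκ
  rw [Multiset.card_cons] at hc hev
  have hc' : Multiset.card κ' ≤ 3 := by omega
  interval_cases h : Multiset.card κ'
  · exact absurd hev (by decide)
  · obtain ⟨x, rfl⟩ := Multiset.card_eq_one.mp h
    have hx : x = -y := by
      have h1 : (y ::ₘ ({x} : Multiset (ZMod 110))).sum = y + x := by simp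
      rw [h1] at hsum
      linear_combination hsum
    subst hx
    simp [Psi, psi_neg]
  · exact absurd hev (by decide)
  · obtain ⟨b, c, d, rfl⟩ := Multiset.card_eq_three.mp h
    have hd : d = -(y + b + c) := by
      have h1 : (y ::ₘ ({b, c, d} : Multiset (ZMod 110))).sum = y + b + c + d := by
        simp [add_assoc]
      rw [h1] at hsum
      linear_combination hsum
    subst hd
    have hH : ∀ x ∈ U110,
        (x * y).val + (x * b).val + (x * c).val + (x * -(y + b + c)).val = 220 := by
      intro x hx
      have h2 := hN' x hx
      simp only [mNormSum, Multiset.insert_eq_cons, Multiset.map_cons, Multiset.map_singleton,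
        Multiset.sum_cons, Multiset.sum_singleton, Multiset.card_cons, Multiset.card_singleton] at h2
      omega
    have hΨ : Psi (y ::ₘ ({b, c, -(y + b + c)} : Multiset (ZMod 110))) =
        psi y + psi b + psi c + psi (-(y + b + c)) := by
      simp only [Psi, Multiset.insert_eq_cons, Multiset.map_cons, Multiset.map_singleton,
        Multiset.sum_cons, Multiset.sum_singleton]
      ring
    rw [hΨ]
    exact core4 y hψ b c hH

/-- Key step for semi-decomposable parts: the first triple contains a point of `supp ψ`. [folklore] -/
private theorem Psi_semidec_aux (t u : Multiset (ZMod 110)) (ht : Multiset.card t = 3)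
    (hu : Multiset.card u = 3) (ht0 : t.sum = 0) (hu0 : u.sum = 0)
    (hN : ∀ x ∈ U110, 2 * mNormSum ((t + u).map fun a => x * a) = 110 * Multiset.card (t + u))
    {y : ZMod 110} (hy : y ∈ t) (hψ : psi y ≠ 0) : Psi (t + u) = 0 := by
  obtain ⟨t', rfl⟩ := Multiset.exists_cons_of_mem hy
  have ht' : Multiset.card t' = 2 := by
    rw [Multiset.card_cons] at ht
    omega
  obtain ⟨b, c, rfl⟩ := Multiset.card_eq_two.mp ht'
  obtain ⟨d, e, f, rfl⟩ := Multiset.card_eq_three.mp hu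
  have hc : c = -(y + b) := by
    have h1 : (y ::ₘ ({b, c} : Multiset (ZMod 110))).sum = y + b + c := by
      simp [add_assoc]
    rw [h1] at ht0
    linear_combination ht0
  have hf : f = -(d + e) := by
    have h1 : ({d, e, f} : Multiset (ZMod 110)).sum = d + e + f := by
      simp [add_assoc]
    rw [h1] at hu0
    linear_combination hu0
  subst hc
  subst hf
  have hH : ∀ x ∈ U110, nrm3 x y b + nrm3 x d e = 330 := by
    intro x hx
    have h2 := hN x hx
    simp only [mNormSum, Multiset.insert_eq_cons, Multiset.cons_add, Multiset.singleton_add,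
      Multiset.map_cons, Multiset.map_singleton, Multiset.sum_cons, Multiset.sum_singleton,
      Multiset.card_cons, Multiset.card_singleton] at h2
    simp only [nrm3]
    omega
  have hΨ : Psi ((y ::ₘ ({b, -(y + b)} : Multiset (ZMod 110))) + {d, e, -(d + e)}) =
      psi3 y b + psi3 d e := by
    simp only [Psi, psi3, Multiset.insert_eq_cons, Multiset.cons_add, Multiset.singleton_add,
      Multiset.map_cons, Multiset.map_singleton, Multiset.sum_cons, Multiset.sum_singleton]
    ring
  rw [hΨ]
  exact core6 hψ hH

/-- Semi-decomposable Hodge parts. [folklore] -/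
private theorem Psi_part6 (κ : Multiset (ZMod 110)) (hκ : IsHodgeMultiset κ)
    (hsd : IsSemiDecomposable κ) : Psi κ = 0 := by
  by_cases hall : ∀ a ∈ κ, psi a = 0
  · exact Psi_eq_zero_of_forall hall
  push Not at hall
  obtain ⟨y, hyκ, hψ⟩ := hall
  obtain ⟨t, u, ht, hu, ht0, hu0, rfl⟩ := hsd
  have hN' := hodge_U110 hκ.2
  rcases Multiset.mem_add.mp hyκ with hy | hy
  · exact Psi_semidec_aux t u ht hu ht0 hu0 hN' hy hψ
  · rw [add_comm] at hN' ⊢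
    exact Psi_semidec_aux u t hu ht hu0 ht0 hN' hy hψ

/-- `5`-standard parts (`m = 110`, `d = 22`). [folklore] -/
private theorem Psi_part5 (κ : Multiset (ZMod 110))
    (h : ∃ a : ZMod 110, Nat.Coprime a.val (110 / 5) ∧
      κ = {a, a + ((110 / 5 : ℕ) : ZMod 110), a + 2 * ((110 / 5 : ℕ) : ZMod 110),
        a + 3 * ((110 / 5 : ℕ) : ZMod 110), a + 4 * ((110 / 5 : ℕ) : ZMod 110), -(5 * a)}) :
    Psi κ = 0 := by
  obtain ⟨a, -, rfl⟩ := h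
  have hΨ : Psi {a, a + ((110 / 5 : ℕ) : ZMod 110), a + 2 * ((110 / 5 : ℕ) : ZMod 110),
      a + 3 * ((110 / 5 : ℕ) : ZMod 110), a + 4 * ((110 / 5 : ℕ) : ZMod 110), -(5 * a)} =
      psi a + psi (a + ((110 / 5 : ℕ) : ZMod 110)) + psi (a + 2 * ((110 / 5 : ℕ) : ZMod 110)) +
      psi (a + 3 * ((110 / 5 : ℕ) : ZMod 110)) + psi (a + 4 * ((110 / 5 : ℕ) : ZMod 110)) +
      psi (-(5 * a)) := by
    simp only [Psi, Multiset.insert_eq_cons, Multiset.map_cons, Multiset.map_singleton,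
      Multiset.sum_cons, Multiset.sum_singleton]
    ring
  rw [hΨ]
  exact core5 a

/-- `Ψ` vanishes on the sum of any family of allowed parts. [folklore] -/
private theorem Psi_parts_sum (parts : Multiset (Multiset (ZMod 110)))
    (hparts : ∀ κ ∈ parts, (IsHodgeMultiset κ ∧ Multiset.card κ ≤ 4) ∨
      (IsHodgeMultiset κ ∧ IsSemiDecomposable κ) ∨
      (5 ∣ 110 ∧ 5 < 110 ∧ ∃ a : ZMod 110, Nat.Coprime a.val (110 / 5) ∧
        κ = {a, a + ((110 / 5 : ℕ) : ZMod 110), a + 2 * ((110 / 5 : ℕ) : ZMod 110),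
          a + 3 * ((110 / 5 : ℕ) : ZMod 110), a + 4 * ((110 / 5 : ℕ) : ZMod 110), -(5 * a)})) :
    Psi parts.sum = 0 := by
  induction parts using Multiset.induction_on with
  | empty => simp [Psi_zero]
  | cons κ parts ih =>
    rw [Multiset.sum_cons, Psi_add, ih fun κ' hκ' => hparts κ' (Multiset.mem_cons_of_mem hκ'),
      add_zero]
    rcases hparts κ (Multiset.mem_cons_self κ parts) with ⟨hκ, hc⟩ | ⟨hκ, hsd⟩ | ⟨-, -, h5⟩
    · exact Psi_part4 κ hκ hc
    · exact Psi_part6 κ hκ hsd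
    · exact Psi_part5 κ h5

/-- A sub-multiset of `s₀` has its elements in `L₀`. [folklore] -/
private theorem mem_of_le_s₀ {b₀ b₁ b₂ : ZMod 110}
    (h : ({b₀, b₁, b₂} : Multiset (ZMod 110)) ≤ s₀) : b₀ ∈ L₀ ∧ b₁ ∈ L₀ ∧ b₂ ∈ L₀ := by
  have hsub := Multiset.subset_of_le h
  have key : ∀ b ∈ s₀, b ∈ L₀ := by decide +kernel
  refine ⟨key _ (hsub ?_), key _ (hsub ?_), key _ (hsub ?_)⟩ <;> simp

/-- `s₀` is not K3-sector: uniqueness of the level-`1` character fails for every split. [folklore] -/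
private theorem not_k3 (β γ : Fin 4 → ZMod 110) (hsum : ∑ i, β i = 0)
    (huniq : ∃! δ : Fin 4 → ZMod 110,
      (∃ t : (ZMod 110)ˣ, δ = fun i => (t : ZMod 110) * β i) ∧ normSum δ = 110)
    (hs : s₀ = ({β 0, β 1, β 2} + {γ 0, γ 1, γ 2} : Multiset (ZMod 110))) : False := by
  have hle : ({β 0, β 1, β 2} : Multiset (ZMod 110)) ≤ s₀ := hs ▸ Multiset.le_add_right _ _
  have h3 : β 3 = -(β 0 + β 1 + β 2) := by
    rw [Fin.sum_univ_four] at hsum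
    linear_combination hsum
  obtain ⟨hm0, hm1, hm2⟩ := mem_of_le_s₀ hle
  obtain ⟨t₁, ht₁, t₂, ht₂, hN₁, hN₂, hne⟩ := coreK3 _ hm0 _ hm1 _ hm2 hle
  have hnorm : ∀ x : ZMod 110, normSum (fun i => x * β i) =
      (x * β 0).val + (x * β 1).val + (x * β 2).val + (x * -(β 0 + β 1 + β 2)).val := by
    intro x
    simp only [normSum, Fin.sum_univ_four, h3]
  have hP : ∀ x ∈ U110,
      (x * β 0).val + (x * β 1).val + (x * β 2).val + (x * -(β 0 + β 1 + β 2)).val = 110 →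
      (∃ t : (ZMod 110)ˣ, (fun i => x * β i) = fun i => (t : ZMod 110) * β i) ∧
        normSum (fun i => x * β i) = 110 := by
    intro x hx hN
    refine ⟨⟨ZMod.unitOfCoprime x.val (coprime_of_mem_U110 x hx), ?_⟩, ?_⟩
    · simp only [ZMod.coe_unitOfCoprime, ZMod.natCast_zmod_val]
    · rw [hnorm x, hN]
  have heq := huniq.unique (hP t₁ ht₁ hN₁) (hP t₂ ht₂ hN₂)
  exact hne ⟨congrFun heq 0, congrFun heq 1, congrFun heq 2⟩

end DerivedTorelliFermatK3ExhaustionRefutation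

set_option linter.dupNamespace false in
open DerivedTorelliFermatK3ExhaustionRefutation in
/-- Refutes `DerivedTorelliFermat.K3Exhaustion` [refuted-substantive]: at `m = 110` the Hodge sextuple
`{1, 24, 62, 71, 81, 91} ⊂ ℤ/110` is neither Shioda–Aoki reachable (the odd functional `ψ = ±1` on
`±{9,13,18,26,29,37}` vanishes on all allowed parts and on cancelling pairs but `Ψ(s₀) = −1`) nor in the
K3 sector (every `3`-sub-multiset gives a surface character with two level-`1` characters in its unit
orbit); witness from an exhaustive census (24 such sextuples at `m = 110`, none below).  No cheap
repair: `ψ` is a new invariant of Shioda's semigroup `M₁₁₀` vanishing on all generators the route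
allows, so more pairs / dropping the coprimality guard change nothing, and restricting `m` breaks the
`∀ m` target `FermatFourfoldsHC`; barrier-candidate: Shioda–Aoki(+pairs)+K3-sector exhaustion of Hodge
sextuples fails from `m = 110` on.  Finite checks by `native_decide` (computational). [folklore] -/
theorem DerivedTorelliFermatK3Exhaustion_refuted :
    ¬ Summit.HodgeConjecture.HodgeConjecture.Theses.DerivedTorelliFermat.K3Exhaustion := by
  intro h
  rcases h 110 s₀ s₀_isHodge s₀_card with ⟨Q, parts, hparts, heq⟩ | ⟨β, γ, ⟨-, hsum, huniq⟩, -, hs⟩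
  · have hΨ := congrArg Psi heq
    rw [Psi_add, Psi_pairs, add_zero, Psi_parts_sum parts hparts, Psi_s₀] at hΨ
    exact absurd hΨ (by decide)
  · exact not_k3 β γ hsum huniq hs

end Summit.HodgeConjecture.HodgeConjecture.Theorems
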